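/-
Copyright (c) 2026 the pub-hodgecm-mathlib formalisation cell (harness21).  Prover seat hodgecm-mathlib-LH3-p02 (g5): line LH3 (closer stub `stub_N9`), LETTER L3′ SURJ-OF-FORWARD,
organ (Σ-WALL) — FILTRATION ROAD (W-ROAD CENSUS v1 6129001bfae4ccc0, RULING #26), brick (W3-G) part 1: the SPLIT READING at a central block.
-/
import Literature.NumberTheory.Automorphic.ArchEndoscopicChartSplitConeLimit      -- ★ (A0-DOCKED-JOINT): docking kit ★ (DOCK-w₀) `chartOrbHLoc_eq_of_chartTorusHLoc_eq`, ★ (T-CONGR) `chartOrbHLoc_eq_of_mem_iff`, `measure_pos_lt_top_of_subgroup_eq`; brings ★ Iwasawa datum (`rotLift`, `lineChart`)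
import Literature.NumberTheory.Automorphic.ArchRankOneSplitOrbitSmooth            -- ★ (A0-smooth) `exists_contDiff_abs_sub_smul_integral_descConj_hypBlockGL_eq` — `F_f^A ∈ C^∞(A)` with the (A0) value
import Literature.NumberTheory.Automorphic.ArchRankOneSplitOrbitEven              -- ★ `integral_descConj_hypBlockGL_neg_eq` — the split reading is EVEN in `x`
import Literature.NumberTheory.Automorphic.ArchEndoscopicChartOrbLocalPos         -- ★ (N2b) `hasCompactSupport_prod_conj`, `integral_prod_conj_pos_of_nonneg` (cone positivity at the vertex)
import HarnessLib

/-!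
# (W3-G), PART 1: THE NORMALISED SPLIT READING `|eˣ − e⁻ˣ| · chartOrbHLoc` OF AN AMBIENT TEST FUNCTION AT A PLACE `w` IS A SMOOTH EVEN FUNCTION OF `(x, θ)` ACROSS THE
# REAL WALL, WITH A POSITIVE CONE FUNCTIONAL AS ITS VALUE (Harish-Chandra `F_f^A ∈ C^∞(A)`; Varadarajan 1989 §6.4; Shelstad 1979 Lemma 4.3; Rogawski 1990 §8.2)

Topic `NumberTheory/Rogawski1990`; namespace `Literature.NumberTheory.Rogawski1990` (§1 generic in `Literature.NumberTheory.Automorphic`).  THEOREMS ONLY (no `def`, no instance,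
no notation, no axiom, no named fact, no `sorry`).  Cell `pub/hodgecm-mathlib`, crux H413 (`stmt-HodgeConjecture-24833`), F0∕P3c line LH3 (closer stub `stub_N9`), LETTER L3′
SURJ-OF-FORWARD, organ (Σ-WALL) = `hwall` of ★ `bouazizSurjOfForward_of_reg_wall`, FILTRATION ROAD (W-ROAD CENSUS v1, LH3-p01 (g6); RULING #26): brick **(W3-G) rank-one
generator facts at a central block**, part 1 = the SPLIT READING (the census's (W3-G)(a)(b) for EVERY ambient test function at once).  Part 2 (`ArchRankOneWallGenerators`):
the split-type and compact-type generators.  Count-neutral.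

THE MATHEMATICS.  At a complex place `w`, for a label `S ∋ w` (the place is SPLIT), the local chart point is `hypBlockGL x θ = diag(e^{x+iθ}, e^{−x+iθ})` (`x = cw 0`,
`θ = cw 2`; slot `1` unread) and ★ `chartOrbHLoc L S w ν_w f cw` is the Haar-normalised orbital integral of `f` over its `U(Φ₂)_w`-class.  By ★ (DOCK-w₀) it is
`D₀ · ∫_{U(Φ₂)_w ⧸ T} f(y · hypBlockGL x θ · y⁻¹) d(ν_w∕t)` with ONE `D₀ > 0` (the box mass), for EVERY label `S ∋ w` (★ (T-CONGR)).  Harish-Chandra: the NORMALISED reading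
`|eˣ − e⁻ˣ| · (that)` extends to a `C^∞` function `G(x, θ)` ACROSS `x = 0` (★ (A0-smooth), Iwasawa form of the quotient measure ★ FILE 1), is EVEN in `x` (★ realised Weyl
reflection), and `G(0, θ) = Λ θ f := D₀ · C · ∫_{K₁ × N} f(e^{iθ} · k n k⁻¹) d(κ ⊗ μ_N)` — Rao's cone value, a POSITIVE functional: `Λ θ f ≠ 0` as soon as `f` is real non-negative
and positive at ONE point `e^{iθ}·n₀` of the unipotent cone (`n₀ ∈ N`; the integrand at `(1, n₀)`).

WHAT IS PROVED.
* §1 (generic `K, N ≤ G`): `integral_prod_conj_pos_of_nonneg_of_ne_zero_mul (z) (n₀ : N) … (hz : f (z * n₀) ≠ 0) : 0 < ∫_{K×N} f(z · k n k⁻¹)` and its `ℂ`-valued reading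
  `smul_integral_prod_conj_ne_zero_of_re_nonneg_of_pos_mul` — the «positive SOMEWHERE ON THE CONE» twins of ★ (N2b) (vertex) needed for generators vanishing at the centre.
* §2 (rank one, `U(J)`, `hJ : J = antidiag`, ANY non-zero invariant Radon `μ` on `U(J) ⧸ T`): **`exists_coneFunctional_splitReading`** — `∃ Λ`, positivity clause as above, and for
  every ambient `f ∈ C_c^∞(M₂(ℂ), ℂ)` a `G ∈ C^∞(ℝ × ℝ)`, even in `x`, `G(0, θ) = Λ θ f`, with `|eˣ − e⁻ˣ| • ∫ descConj (hypBlockGL x θ) (f ∘ coe) ∂μ = G (x, θ)` for `x ≠ 0`.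
* §3 (docked at a place `w`, Haar `ν_w`): **`exists_splitReading_contDiff_even`** — the same with `↑|eˣ − e⁻ˣ| * chartOrbHLoc L S w ν_w (f ∘ coe) cw = G (cw 0, cw 2)` for EVERY label
  `S ∋ w` and every `cw` with `cw 0 ≠ 0` (head 1 of the (W3-G) sigfirst 2026-09-02, LH3-p02 (g5)).
HONEST LABEL: HC_CM is proved only modulo the 7 printed citations (2 remaining: hLiu418 = `stmt-HodgeConjecture-24832`, h413 = `stmt-HodgeConjecture-24833`) until rung 0 closes;
rank-one measure theory over the ★ kit, pays nothing by itself.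

## References
* [Varadarajan1989] V. S. Varadarajan, *An Introduction to Harmonic Analysis on Semisimple Lie Groups*, Cambridge Stud. Adv. Math. 16 (1989), §6.4 Lemma 21, Thm 23.
* [Shelstad1979] D. Shelstad, *Characters and inner forms of a quasi-split group over ℝ*, Compositio Math. 39 (1979), Lemma 4.3 p. 25, §4 pp. 22–23.
* [Rogawski1990] J. D. Rogawski, *Automorphic Representations of Unitary Groups in Three Variables*, Ann. of Math. Stud. 123 (1990), §3.6 p. 31, §8.2 pp. 119–122, §8.3 p. 124.
* [DeitmarEchterhoff2014] A. Deitmar, S. Echterhoff, *Principles of Harmonic Analysis*, 2nd ed. (2014), Thm. 1.5.3 (invariant quotient measures).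
-/

set_option autoImplicit false

noncomputable section

open MeasureTheory MeasureTheory.Measure Set Filter Topology NumberField NumberField.InfinitePlace
open scoped ENNReal NNReal ComplexConjugate Real MatrixGroups Matrix ContDiff Matrix.Norms.Operator

namespace Literature.NumberTheory.Automorphic

open Literature.MeasureTheory.Group

/-! ## §1 Generic: the `K × N` cone integral of a non-negative function positive SOMEWHERE on the cone is positive -/

section Cone

variable {G : Type*} [Group G] [TopologicalSpace G] [IsTopologicalGroup G]
  (K N : Subgroup G) (hK : IsCompact (K : Set G)) (hN : IsClosed (N : Set G))
  [SecondCountableTopology G] [MeasurableSpace ↥K] [BorelSpace ↥K] [MeasurableSpace ↥N] [BorelSpace ↥N]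
  (κ : Measure ↥K) (μN : Measure ↥N) [IsFiniteMeasureOnCompacts κ] [IsFiniteMeasureOnCompacts μN] [κ.IsOpenPosMeasure] [μN.IsOpenPosMeasure] [SFinite μN]

include hK hN in
/-- **THE `K × N` CONE INTEGRAL OF A NON-NEGATIVE FUNCTION POSITIVE AT ONE CONE POINT `z · n₀` IS POSITIVE** (`K` compact, `N` closed, `κ`, `μ_N` finite on compacta and charging open
sets): the integrand `(k, n) ↦ f(z · k n k⁻¹)` is continuous, non-negative, compactly supported (★ `hasCompactSupport_prod_conj`) and equals `f(z · n₀) > 0` at `(1, n₀)`.  The twin of ★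
`integral_prod_conj_pos_of_nonneg` (positivity at the VERTEX `n₀ = 1`) for test functions that vanish at the centre. [cite: Varadarajan1989, §6.4 Thm 23] [cite: Shelstad1979, Lemma 4.3 p. 25] -/
theorem integral_prod_conj_pos_of_nonneg_of_ne_zero_mul (z : G) (n₀ : ↥N) {f : G → ℝ} (hf : Continuous f) (hfc : HasCompactSupport f) (h0 : 0 ≤ f)
    (hz : f (z * (n₀ : G)) ≠ 0) :
    0 < ∫ p : ↥K × ↥N, f (z * ((p.1 : G) * (p.2 : G) * (p.1 : G)⁻¹)) ∂(κ.prod μN) := by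
  haveI : SecondCountableTopology ↥K := TopologicalSpace.Subtype.secondCountableTopology _
  haveI : SecondCountableTopology ↥N := TopologicalSpace.Subtype.secondCountableTopology _
  haveI : BorelSpace (↥K × ↥N) := Prod.borelSpace
  have hgc : Continuous fun p : ↥K × ↥N => f (z * ((p.1 : G) * (p.2 : G) * (p.1 : G)⁻¹)) := by
    have h1 : Continuous fun p : ↥K × ↥N => ((p.1 : ↥K) : G) := continuous_subtype_val.comp continuous_fst
    have h2 : Continuous fun p : ↥K × ↥N => ((p.2 : ↥N) : G) := continuous_subtype_val.comp continuous_snd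
    exact hf.comp (continuous_const.mul ((h1.mul h2).mul h1.inv))
  have hgs := hasCompactSupport_prod_conj K N hK hN z hfc
  refine integral_pos_of_integrable_nonneg_nonzero hgc (hgc.integrable_of_hasCompactSupport hgs) (fun p => h0 _) (x := ((1 : ↥K), n₀)) ?_
  simpa only [OneMemClass.coe_one, one_mul, inv_one, mul_one] using hz

include hK hN in
/-- The `ℂ`-valued reading with a non-zero scalar: for `F : G → ℂ` continuous, compactly supported, `0 ≤ re F`, `im F = 0` and `0 < re F(z · n₀)` at one cone point,
`C • ∫_{K × N} F(z · k n k⁻¹) d(κ ⊗ μ_N) ≠ 0`. [cite: Varadarajan1989, §6.4 Thm 23] -/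
theorem smul_integral_prod_conj_ne_zero_of_re_nonneg_of_pos_mul {C : ℝ} (hC : C ≠ 0) (z : G) (n₀ : ↥N) {F : G → ℂ} (hF : Continuous F) (hFc : HasCompactSupport F)
    (h0 : ∀ g, 0 ≤ (F g).re ∧ (F g).im = 0) (hz : 0 < (F (z * (n₀ : G))).re) :
    C • ∫ p : ↥K × ↥N, F (z * ((p.1 : G) * (p.2 : G) * (p.1 : G)⁻¹)) ∂(κ.prod μN) ≠ 0 := by
  set f : G → ℝ := fun g => (F g).re with hfdef
  have hFeq : ∀ g, F g = ((f g : ℝ) : ℂ) := fun g => Complex.ext (by simp [hfdef]) (by simp [hfdef, (h0 g).2])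
  have hint : (fun p : ↥K × ↥N => F (z * ((p.1 : G) * (p.2 : G) * (p.1 : G)⁻¹))) =
      fun p : ↥K × ↥N => ((f (z * ((p.1 : G) * (p.2 : G) * (p.1 : G)⁻¹)) : ℝ) : ℂ) :=
    funext fun p => hFeq _
  rw [hint, integral_complex_ofReal, smul_ne_zero_iff]
  refine ⟨hC, ?_⟩
  rw [Complex.ofReal_ne_zero]
  exact (integral_prod_conj_pos_of_nonneg_of_ne_zero_mul K N hK hN κ μN z n₀ (Complex.continuous_re.comp hF) (hFc.comp_left Complex.zero_re)
    (fun g => (h0 g).1) hz.ne').ne'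

end Cone

/-! ## §2 Rank one: the cone functional and the smooth even split reading on `U(J) ⧸ T`, for ANY non-zero invariant Radon measure -/

namespace UnitaryGroup

section RankOne

open Literature.NumberTheory.Rogawski1990 Literature.NumberTheory.Automorphic.UnitaryGroup.LineRing

variable {J : Matrix (Fin 2) (Fin 2) ℂ} (hJ : J = (StdForm.antidiagonal 2).over ℂ)

include hJ in
/-- **THE CONE FUNCTIONAL AND THE SMOOTH EVEN SPLIT READING on `U(J) ⧸ T`** (`J` the antidiagonal form, `T = torusU` the split torus, `μ ≠ 0` ANY invariant Radon measure on `U(J) ⧸ T`):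
there is `Λ : ℝ → (M₂(ℂ) → ℂ) → ℂ` — `Λ θ f = C · ∫_{K₁ × N} f(↑↑(e^{iθ}·1 · k n k⁻¹)) d(κ ⊗ μ_N)` for ONE Iwasawa datum (★ `exists_measure_quotient_torusU_complex_two_eq_smul_map`) — with
(i) `Λ θ f ≠ 0` whenever `f` is continuous, compactly supported, real non-negative and `0 < re f(e^{iθ} · ↑↑n₀)` at ONE `n₀ ∈ N` (§1), and (ii) for every `f ∈ C_c^∞(M₂(ℂ), ℂ)` a
`G ∈ C^∞(ℝ × ℝ)`, EVEN in `x` (★ `integral_descConj_hypBlockGL_neg_eq`), with `G(0, θ) = Λ θ f` and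
`|eˣ − e⁻ˣ| • ∫_{U(J)⧸T} f(↑↑(y · hypBlockGL x θ · y⁻¹)) dμ = G (x, θ)` for `x ≠ 0` (★ (A0-smooth) `exists_contDiff_abs_sub_smul_integral_descConj_hypBlockGL_eq`).
[cite: Varadarajan1989, §6.4 Lemma 21, Thm 23] [cite: Shelstad1979, Lemma 4.3 p. 25; §4 pp. 22–23] [cite: Rogawski1990, §8.2 pp. 119–122] -/
theorem exists_coneFunctional_splitReading [Fact (0 < 2 * π)]
    [MeasurableSpace ↥(unitaryGroupOfForm (starRingEnd ℂ) J)] [BorelSpace ↥(unitaryGroupOfForm (starRingEnd ℂ) J)]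
    [MeasurableSpace (↥(unitaryGroupOfForm (starRingEnd ℂ) J) ⧸ torusU (starRingEnd ℂ) J)]
    [BorelSpace (↥(unitaryGroupOfForm (starRingEnd ℂ) J) ⧸ torusU (starRingEnd ℂ) J)]
    (μ : Measure (↥(unitaryGroupOfForm (starRingEnd ℂ) J) ⧸ torusU (starRingEnd ℂ) J))
    [SMulInvariantMeasure ↥(unitaryGroupOfForm (starRingEnd ℂ) J) (↥(unitaryGroupOfForm (starRingEnd ℂ) J) ⧸ torusU (starRingEnd ℂ) J) μ]
    [IsFiniteMeasureOnCompacts μ] (hμ : μ ≠ 0) :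
    ∃ Λ : ℝ → (Matrix (Fin 2) (Fin 2) ℂ → ℂ) → ℂ,
      (∀ (θ : ℝ) (f : Matrix (Fin 2) (Fin 2) ℂ → ℂ), Continuous f → HasCompactSupport f → (∀ X, 0 ≤ (f X).re ∧ (f X).im = 0) →
        (∃ n₀ : ↥(unitaryGroupOfForm (starRingEnd ℂ) J), n₀ ∈ unipotentU (starRingEnd ℂ) J ∧
          0 < (f (Complex.exp ((θ : ℂ) * Complex.I) • ((n₀ : GL (Fin 2) ℂ) : Matrix (Fin 2) (Fin 2) ℂ))).re) → Λ θ f ≠ 0) ∧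
      ∀ f : Matrix (Fin 2) (Fin 2) ℂ → ℂ, ContDiff ℝ ∞ f → HasCompactSupport f →
        ∃ G : ℝ × ℝ → ℂ, ContDiff ℝ ∞ G ∧ (∀ x θ, G (-x, θ) = G (x, θ)) ∧ (∀ θ, G (0, θ) = Λ θ f) ∧
          ∀ x θ : ℝ, x ≠ 0 →
            |Real.exp x - Real.exp (-x)| •
              ∫ y, descConj (⟨hypBlockGL x θ, hypBlockGL_mem_of_eq_over hJ x θ⟩ : ↥(unitaryGroupOfForm (starRingEnd ℂ) J)) (torusU (starRingEnd ℂ) J)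
                (LineRing.forall_mem_torusU_comm (starRingEnd ℂ) J (hypBlockGL_mem_torusU hJ x θ))
                (fun g : ↥(unitaryGroupOfForm (starRingEnd ℂ) J) => f ((g : GL (Fin 2) ℂ) : Matrix (Fin 2) (Fin 2) ℂ)) y ∂μ = G (x, θ) := by
  -- instances on `G`, `T`, `N`
  haveI : LocallyCompactSpace ↥(unitaryGroupOfForm (starRingEnd ℂ) J) := locallyCompactSpace_unitaryGroupOfForm_complex J
  haveI : SecondCountableTopology ↥(unitaryGroupOfForm (starRingEnd ℂ) J) := secondCountableTopology_unitaryGroupOfForm_complex J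
  have hT : IsClosed (torusU (starRingEnd ℂ) J : Set ↥(unitaryGroupOfForm (starRingEnd ℂ) J)) := isClosed_torusU_two _ _
  have hN : IsClosed (unipotentU (starRingEnd ℂ) J : Set ↥(unitaryGroupOfForm (starRingEnd ℂ) J)) := isClosed_unipotentU _ _
  haveI : LocallyCompactSpace ↥(torusU (starRingEnd ℂ) J) := hT.isClosedEmbedding_subtypeVal.locallyCompactSpace
  haveI : LocallyCompactSpace ↥(unipotentU (starRingEnd ℂ) J) := hN.isClosedEmbedding_subtypeVal.locallyCompactSpace
  haveI : SecondCountableTopology ↥(unipotentU (starRingEnd ℂ) J) := TopologicalSpace.Subtype.secondCountableTopology _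
  haveI : BorelSpace ↥(torusU (starRingEnd ℂ) J) := Subtype.borelSpace _
  haveI : BorelSpace ↥(unipotentU (starRingEnd ℂ) J) := Subtype.borelSpace _
  -- the circle `K₁` as a subgroup, compact, with `G = K₁ · B`
  set ι : AddCircle (2 * π) → ↥(unitaryGroupOfForm (starRingEnd ℂ) J) :=
    fun s => ⟨archPlaneLiftGL 1 (rotMat s) (det_rotMat s), archPlaneLiftGL_rotMat_mem hJ s⟩ with hι
  have hιadd : ∀ s t, ι (s + t) = ι s * ι t := fun s t => Subtype.ext (archPlaneLiftGL_rotMat_add s t)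
  have hι0 : ι 0 = 1 := Subtype.ext archPlaneLiftGL_rotMat_zero
  have hιneg : ∀ s, ι (-s) = (ι s)⁻¹ := fun s => Subtype.ext (by
    rw [Subgroup.coe_inv]; exact archPlaneLiftGL_rotMat_neg s)
  let K : Subgroup ↥(unitaryGroupOfForm (starRingEnd ℂ) J) :=
    { carrier := Set.range ι
      one_mem' := ⟨0, hι0⟩
      mul_mem' := by
        rintro _ _ ⟨s, rfl⟩ ⟨t, rfl⟩
        exact ⟨s + t, hιadd s t⟩
      inv_mem' := by
        rintro _ ⟨s, rfl⟩
        exact ⟨-s, hιneg s⟩ }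
  have hKmem : ∀ s, ι s ∈ K := fun s => ⟨s, rfl⟩
  have hKmem' : ∀ k ∈ K, ∃ s, k = ι s := fun k ⟨s, hs⟩ => ⟨s, hs.symm⟩
  have hK : IsCompact (K : Set ↥(unitaryGroupOfForm (starRingEnd ℂ) J)) := isCompact_range_rotLift hJ
  have hKB : ∀ g : ↥(unitaryGroupOfForm (starRingEnd ℂ) J), ∃ k ∈ K, ∃ b ∈ borelU (starRingEnd ℂ) J, g = k * b := by
    intro g
    obtain ⟨s, b, hb, hg⟩ := exists_rotLift_mul_mem_borelU hJ g
    exact ⟨ι s, hKmem s, b, hb, hg⟩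
  haveI : CompactSpace ↥K := isCompact_iff_compactSpace.1 hK
  haveI : BorelSpace ↥K := Subtype.borelSpace _
  -- Haar measures: `κ` on `K₁`, `μ_N` on `N`, `α` on `T`
  set ι' : AddCircle (2 * π) → ↥K := fun s => ⟨ι s, hKmem s⟩ with hι'
  set κ : Measure ↥K := Measure.map ι' volume with hκ
  haveI hκH : IsHaarMeasure κ := isHaarMeasure_map_rotLift hJ K hKmem hKmem'
  obtain ⟨ψ, hψc, hψadd, hψ01, hψH⟩ := exists_lineChart_real_isHaarMeasure_map hJ
  set μN : Measure ↥(unipotentU (starRingEnd ℂ) J) := Measure.map ψ volume with hμN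
  haveI : IsHaarMeasure μN := hψH
  set α : Measure ↥(torusU (starRingEnd ℂ) J) := Measure.haar with hα
  -- ★ FILE 1: the Iwasawa form of `μ`
  obtain ⟨C, hC0, hμC⟩ := exists_measure_quotient_torusU_complex_two_eq_smul_map hJ hK hKB κ α μN μ hμ
  have hCne : (C : ℝ) ≠ 0 := NNReal.coe_ne_zero.2 hC0
  -- the cone functional
  refine ⟨fun θ f => (C : ℝ) • ∫ p : ↥K × ↥(unipotentU (starRingEnd ℂ) J),
      f ((((⟨hypBlockGL 0 θ, hypBlockGL_mem_of_eq_over hJ 0 θ⟩ : ↥(unitaryGroupOfForm (starRingEnd ℂ) J)) *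
        ((p.1 : ↥(unitaryGroupOfForm (starRingEnd ℂ) J)) * (p.2 : ↥(unitaryGroupOfForm (starRingEnd ℂ) J)) * (p.1 : ↥(unitaryGroupOfForm (starRingEnd ℂ) J))⁻¹) :
          ↥(unitaryGroupOfForm (starRingEnd ℂ) J)) : GL (Fin 2) ℂ) : Matrix (Fin 2) (Fin 2) ℂ) ∂(κ.prod μN), ?_, ?_⟩
  · -- (i) positivity at one cone point
    intro θ f hf hfc h0 hpos
    obtain ⟨n₀, hn₀, hn₀pos⟩ := hpos
    set F : ↥(unitaryGroupOfForm (starRingEnd ℂ) J) → ℂ := fun g => f ((g : GL (Fin 2) ℂ) : Matrix (Fin 2) (Fin 2) ℂ) with hFdef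
    have hF : Continuous F := hf.comp (Units.continuous_val.comp continuous_subtype_val)
    have hFc : HasCompactSupport F := hasCompactSupport_comp_coe hJ f hfc
    have hz : 0 < (F ((⟨hypBlockGL 0 θ, hypBlockGL_mem_of_eq_over hJ 0 θ⟩ : ↥(unitaryGroupOfForm (starRingEnd ℂ) J)) *
        ((⟨n₀, hn₀⟩ : ↥(unipotentU (starRingEnd ℂ) J)) : ↥(unitaryGroupOfForm (starRingEnd ℂ) J)))).re := by
      simp only [hFdef, Subgroup.coe_mul, Units.val_mul, coe_hypBlockGL_zero_left, smul_mul_assoc, one_mul]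
      exact hn₀pos
    exact smul_integral_prod_conj_ne_zero_of_re_nonneg_of_pos_mul K (unipotentU (starRingEnd ℂ) J) hK hN κ μN hCne
      (⟨hypBlockGL 0 θ, hypBlockGL_mem_of_eq_over hJ 0 θ⟩ : ↥(unitaryGroupOfForm (starRingEnd ℂ) J)) ⟨n₀, hn₀⟩ hF hFc (fun g => h0 _) hz
  · -- (ii) the smooth even reading
    intro f hf hfc
    set F : ↥(unitaryGroupOfForm (starRingEnd ℂ) J) → ℂ := fun g => f ((g : GL (Fin 2) ℂ) : Matrix (Fin 2) (Fin 2) ℂ) with hFdef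
    have hFc : HasCompactSupport F := hasCompactSupport_comp_coe hJ f hfc
    obtain ⟨G, hG, hGeq, hG0⟩ := exists_contDiff_abs_sub_smul_integral_descConj_hypBlockGL_eq hJ κ μN μ hK hμC F f hf (fun g => rfl) hFc
    refine ⟨G, hG, fun x θ => ?_, fun θ => hG0 θ, fun x θ hx => hGeq (x, θ) hx⟩
    -- evenness: off the wall both sides are the split reading (★ realised Weyl reflection); on the wall `-0 = 0`
    by_cases hx : x = 0
    · rw [hx, neg_zero]
    · have h1 := hGeq (-x, θ) (neg_ne_zero.2 hx)
      have h2 := hGeq (x, θ) hx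
      simp only at h1 h2
      rw [← h1, ← h2, integral_descConj_hypBlockGL_neg_eq hJ μ F x θ, neg_neg, abs_sub_comm]

end RankOne

end UnitaryGroup

end Literature.NumberTheory.Automorphic

/-! ## §3 Docked at a place `w`: the split reading `↑|eˣ − e⁻ˣ| · chartOrbHLoc L S w ν_w (f ∘ coe) cw` -/

namespace Literature.NumberTheory.Rogawski1990

open Literature.NumberTheory.Automorphic Literature.NumberTheory.Automorphic.UnitaryGroup Literature.MeasureTheory.Group
open Literature.NumberTheory.Automorphic.UnitaryGroup.LineRing

section Docked

variable (L : Type) [Field L] [NumberField L] [IsCMField L] (w : {w : InfinitePlace L // IsComplex w})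
  [MeasurableSpace ↥(archLocal L 2 (Matrix.of fun i j : Fin 2 => if i.val + j.val + 1 = 2 then (1 : L) else 0) w)]
  [BorelSpace ↥(archLocal L 2 (Matrix.of fun i j : Fin 2 => if i.val + j.val + 1 = 2 then (1 : L) else 0) w)]
  (νw : Measure ↥(archLocal L 2 (Matrix.of fun i j : Fin 2 => if i.val + j.val + 1 = 2 then (1 : L) else 0) w)) [νw.IsHaarMeasure] [νw.IsMulRightInvariant]

/-- **(W3-G, SPLIT READING) THE NORMALISED SPLIT READING OF AN AMBIENT TEST FUNCTION AT THE PLACE `w` IS A SMOOTH EVEN FUNCTION OF `(x, θ)` ACROSS THE REAL WALL, WITH A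
POSITIVE CONE FUNCTIONAL AS VALUE.**  For every complex place `w` and Haar `ν_w` on `U(Φ₂)_w` there is `Λ : ℝ → (M₂(ℂ) → ℂ) → ℂ` with: (i) `Λ θ f₀ ≠ 0` for every continuous
compactly supported REAL NON-NEGATIVE `f₀` positive at ONE point `e^{iθ} · ↑↑n₀` of the unipotent cone of `U(Φ₂)_w` (`n₀ ∈ unipotentU`); (ii) for every `f₀ ∈ C_c^∞(M₂(ℂ), ℂ)` a
`G ∈ C^∞(ℝ × ℝ)`, EVEN in `x`, with `G (0, θ) = Λ θ f₀` and, for EVERY label `S ∋ w` and every local coordinate `cw` with `cw 0 ≠ 0`,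
`↑|e^{cw 0} − e^{−cw 0}| * chartOrbHLoc L S w ν_w (f₀ ∘ coe) cw = G (cw 0, cw 2)` (slot `1` unread).  Assembly: ★ (T-CONGR) reduces `S` to `{w}`, ★ (DOCK-w₀) reads
`chartOrbHLoc L {w} w` through the split torus with the box mass `D₀ > 0`, §2 on the canonical quotient measure; `Λ` and `G` are `D₀ ·` those of §2.
[cite: Varadarajan1989, §6.4 Lemma 21, Thm 23] [cite: Shelstad1979, Lemma 4.3 p. 25] [cite: Rogawski1990, §8.2 pp. 119–122; §8.3 p. 124] [cite: DeitmarEchterhoff2014, Thm. 1.5.3] -/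
theorem exists_splitReading_contDiff_even :
    ∃ Λ : ℝ → (Matrix (Fin 2) (Fin 2) ℂ → ℂ) → ℂ,
      (∀ (θ : ℝ) (f₀ : Matrix (Fin 2) (Fin 2) ℂ → ℂ), Continuous f₀ → HasCompactSupport f₀ → (∀ X, 0 ≤ (f₀ X).re ∧ (f₀ X).im = 0) →
        (∃ n₀ : ↥(archLocal L 2 (Matrix.of fun i j : Fin 2 => if i.val + j.val + 1 = 2 then (1 : L) else 0) w),
          n₀ ∈ unipotentU (starRingEnd ℂ) ((Matrix.of fun i j : Fin 2 => if i.val + j.val + 1 = 2 then (1 : L) else 0).map w.1.embedding) ∧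
          0 < (f₀ (Complex.exp ((θ : ℂ) * Complex.I) • ((n₀ : GL (Fin 2) ℂ) : Matrix (Fin 2) (Fin 2) ℂ))).re) → Λ θ f₀ ≠ 0) ∧
      ∀ f₀ : Matrix (Fin 2) (Fin 2) ℂ → ℂ, ContDiff ℝ ∞ f₀ → HasCompactSupport f₀ →
        ∃ G : ℝ × ℝ → ℂ, ContDiff ℝ ∞ G ∧ (∀ x θ, G (-x, θ) = G (x, θ)) ∧ (∀ θ, G (0, θ) = Λ θ f₀) ∧
          ∀ S : Finset {w : InfinitePlace L // IsComplex w}, w ∈ S → ∀ cw : Fin 3 → ℝ, cw 0 ≠ 0 →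
            (((|Real.exp (cw 0) - Real.exp (-(cw 0))| : ℝ) : ℂ) *
              chartOrbHLoc L S w νw (fun g => f₀ ((g : GL (Fin 2) ℂ) : Matrix (Fin 2) (Fin 2) ℂ)) cw) = G (cw 0, cw 2) := by
  haveI : Fact (0 < 2 * π) := ⟨Real.two_pi_pos⟩
  haveI := locallyCompactSpace_archLocal_two L w
  haveI := secondCountableTopology_archLocal_two L w
  -- `U(Φ₂)_w` is BY DEFINITION `U(conj, σ_w Φ₂)(ℂ)` and `σ_w Φ₂ = Φ₂`; work in that spelling (★ (DOCK-w₀) recipe)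
  have hJ : ((Matrix.of fun i j : Fin 2 => if i.val + j.val + 1 = 2 then (1 : L) else 0).map w.1.embedding) = (StdForm.antidiagonal 2).over ℂ := by
    rw [Literature.NumberTheory.Rogawski1990.antidiagOne_map, StdForm.over_antidiagonal_eq]
  letI iG : MeasurableSpace ↥(unitaryGroupOfForm (starRingEnd ℂ) ((Matrix.of fun i j : Fin 2 => if i.val + j.val + 1 = 2 then (1 : L) else 0).map w.1.embedding)) := ‹MeasurableSpace ↥(archLocal L 2 (Matrix.of fun i j : Fin 2 => if i.val + j.val + 1 = 2 then (1 : L) else 0) w)›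
  haveI : BorelSpace ↥(unitaryGroupOfForm (starRingEnd ℂ) ((Matrix.of fun i j : Fin 2 => if i.val + j.val + 1 = 2 then (1 : L) else 0).map w.1.embedding)) := ‹BorelSpace ↥(archLocal L 2 (Matrix.of fun i j : Fin 2 => if i.val + j.val + 1 = 2 then (1 : L) else 0) w)›
  haveI : LocallyCompactSpace ↥(unitaryGroupOfForm (starRingEnd ℂ) ((Matrix.of fun i j : Fin 2 => if i.val + j.val + 1 = 2 then (1 : L) else 0).map w.1.embedding)) := locallyCompactSpace_unitaryGroupOfForm_complex _
  haveI : SecondCountableTopology ↥(unitaryGroupOfForm (starRingEnd ℂ) ((Matrix.of fun i j : Fin 2 => if i.val + j.val + 1 = 2 then (1 : L) else 0).map w.1.embedding)) := secondCountableTopology_unitaryGroupOfForm_complex _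
  let νw' : Measure ↥(unitaryGroupOfForm (starRingEnd ℂ) ((Matrix.of fun i j : Fin 2 => if i.val + j.val + 1 = 2 then (1 : L) else 0).map w.1.embedding)) := νw
  haveI : νw'.IsHaarMeasure := ‹νw.IsHaarMeasure›
  haveI : νw'.IsMulRightInvariant := ‹νw.IsMulRightInvariant›
  -- the diagonal torus `T = torusU`: closed, abelian, with an inversion-invariant Haar measure `t`
  have hTc : IsClosed ((torusU (starRingEnd ℂ) ((Matrix.of fun i j : Fin 2 => if i.val + j.val + 1 = 2 then (1 : L) else 0).map w.1.embedding) : Subgroup ↥(unitaryGroupOfForm (starRingEnd ℂ) ((Matrix.of fun i j : Fin 2 => if i.val + j.val + 1 = 2 then (1 : L) else 0).map w.1.embedding))) : Set ↥(unitaryGroupOfForm (starRingEnd ℂ) ((Matrix.of fun i j : Fin 2 => if i.val + j.val + 1 = 2 then (1 : L) else 0).map w.1.embedding))) := isClosed_torusU_two _ _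
  haveI : LocallyCompactSpace ↥(torusU (starRingEnd ℂ) ((Matrix.of fun i j : Fin 2 => if i.val + j.val + 1 = 2 then (1 : L) else 0).map w.1.embedding)) := hTc.isClosedEmbedding_subtypeVal.locallyCompactSpace
  haveI : SecondCountableTopology ↥(torusU (starRingEnd ℂ) ((Matrix.of fun i j : Fin 2 => if i.val + j.val + 1 = 2 then (1 : L) else 0).map w.1.embedding)) := TopologicalSpace.Subtype.secondCountableTopology _
  haveI : BorelSpace ↥(torusU (starRingEnd ℂ) ((Matrix.of fun i j : Fin 2 => if i.val + j.val + 1 = 2 then (1 : L) else 0).map w.1.embedding)) := Subtype.borelSpace _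
  set t : Measure ↥(torusU (starRingEnd ℂ) ((Matrix.of fun i j : Fin 2 => if i.val + j.val + 1 = 2 then (1 : L) else 0).map w.1.embedding)) := Measure.haar with ht
  haveI : t.IsInvInvariant :=
    Literature.MeasureTheory.Group.isInvInvariant_of_comm _ hTc (fun x hx y hy => LineRing.forall_mem_torusU_comm (starRingEnd ℂ) _ hy x hx) t
  -- the quotient `U(Φ₂)_w ⧸ T`, Borel, and the quotient measure `ν_w ∕ t`: invariant, Radon, non-zero
  letI iQ : MeasurableSpace (↥(unitaryGroupOfForm (starRingEnd ℂ) ((Matrix.of fun i j : Fin 2 => if i.val + j.val + 1 = 2 then (1 : L) else 0).map w.1.embedding)) ⧸ torusU (starRingEnd ℂ) ((Matrix.of fun i j : Fin 2 => if i.val + j.val + 1 = 2 then (1 : L) else 0).map w.1.embedding)) := borel _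
  haveI iQB : BorelSpace (↥(unitaryGroupOfForm (starRingEnd ℂ) ((Matrix.of fun i j : Fin 2 => if i.val + j.val + 1 = 2 then (1 : L) else 0).map w.1.embedding)) ⧸ torusU (starRingEnd ℂ) ((Matrix.of fun i j : Fin 2 => if i.val + j.val + 1 = 2 then (1 : L) else 0).map w.1.embedding)) := ⟨rfl⟩
  haveI : SMulInvariantMeasure ↥(unitaryGroupOfForm (starRingEnd ℂ) ((Matrix.of fun i j : Fin 2 => if i.val + j.val + 1 = 2 then (1 : L) else 0).map w.1.embedding)) (↥(unitaryGroupOfForm (starRingEnd ℂ) ((Matrix.of fun i j : Fin 2 => if i.val + j.val + 1 = 2 then (1 : L) else 0).map w.1.embedding)) ⧸ torusU (starRingEnd ℂ) ((Matrix.of fun i j : Fin 2 => if i.val + j.val + 1 = 2 then (1 : L) else 0).map w.1.embedding)) (quotientMeasure (torusU (starRingEnd ℂ) ((Matrix.of fun i j : Fin 2 => if i.val + j.val + 1 = 2 then (1 : L) else 0).map w.1.embedding)) t hTc νw') := smulInvariantMeasure_quotientMeasure (torusU (starRingEnd ℂ) ((Matrix.of fun i j : Fin 2 => if i.val + j.val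 + 1 = 2 then (1 : L) else 0).map w.1.embedding)) t hTc νw'
  have hμ : (quotientMeasure (torusU (starRingEnd ℂ) ((Matrix.of fun i j : Fin 2 => if i.val + j.val + 1 = 2 then (1 : L) else 0).map w.1.embedding)) t hTc νw') ≠ 0 := quotientMeasure_ne_zero (torusU (starRingEnd ℂ) ((Matrix.of fun i j : Fin 2 => if i.val + j.val + 1 = 2 then (1 : L) else 0).map w.1.embedding)) t hTc νw'
  haveI hreg : (quotientMeasure (torusU (starRingEnd ℂ) ((Matrix.of fun i j : Fin 2 => if i.val + j.val + 1 = 2 then (1 : L) else 0).map w.1.embedding)) t hTc νw').Regular := regular_quotientMeasure (torusU (starRingEnd ℂ) ((Matrix.of fun i j : Fin 2 => if i.val + j.val + 1 = 2 then (1 : L) else 0).map w.1.embedding)) t hTc νw'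
  haveI : IsFiniteMeasureOnCompacts (quotientMeasure (torusU (starRingEnd ℂ) ((Matrix.of fun i j : Fin 2 => if i.val + j.val + 1 = 2 then (1 : L) else 0).map w.1.embedding)) t hTc νw') := hreg.toIsFiniteMeasureOnCompacts
  -- §2 on the quotient
  obtain ⟨Λ, hΛpos, hΛ⟩ := exists_coneFunctional_splitReading hJ (quotientMeasure (torusU (starRingEnd ℂ) ((Matrix.of fun i j : Fin 2 => if i.val + j.val + 1 = 2 then (1 : L) else 0).map w.1.embedding)) t hTc νw') hμ
  -- the box of the reference label `{w}` read inside `torusU` has positive finite `t`-mass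
  have hw1 : w ∈ ({w} : Finset {w : InfinitePlace L // IsComplex w}) := Finset.mem_singleton_self w
  let TAL : Subgroup ↥(archLocal L 2 (Matrix.of fun i j : Fin 2 => if i.val + j.val + 1 = 2 then (1 : L) else 0) w) := torusU (starRingEnd ℂ) ((Matrix.of fun i j : Fin 2 => if i.val + j.val + 1 = 2 then (1 : L) else 0).map w.1.embedding)
  let tAL : Measure ↥TAL := t
  haveI : tAL.IsHaarMeasure := (inferInstance : t.IsHaarMeasure)
  haveI : tAL.IsInvInvariant := ‹t.IsInvInvariant›
  letI iQ' : MeasurableSpace (↥(archLocal L 2 (Matrix.of fun i j : Fin 2 => if i.val + j.val + 1 = 2 then (1 : L) else 0) w) ⧸ TAL) := iQ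
  haveI : BorelSpace (↥(archLocal L 2 (Matrix.of fun i j : Fin 2 => if i.val + j.val + 1 = 2 then (1 : L) else 0) w) ⧸ TAL) := iQB
  obtain ⟨hBpos, hBfin⟩ := measure_pos_lt_top_of_subgroup_eq (T' := TAL) (chartTorusHLoc_eq_torusU L {w} hw1) (chartBoxImgLoc L {w} w)
    (isCompact_chartBoxImgLoc L {w} w) (nonempty_interior_chartBoxImgLoc L {w} w) tAL
  set D₀ : ℝ := (tAL {m : ↥TAL | (m : ↥(archLocal L 2 (Matrix.of fun i j : Fin 2 => if i.val + j.val + 1 = 2 then (1 : L) else 0) w)) ∈ ((↑) : ↥(chartTorusHLoc L {w} w) → ↥(archLocal L 2 (Matrix.of fun i j : Fin 2 => if i.val + j.val + 1 = 2 then (1 : L) else 0) w)) '' chartBoxImgLoc L {w} w}).toReal with hD₀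
  have hD : 0 < D₀ := ENNReal.toReal_pos hBpos.ne' hBfin.ne
  refine ⟨fun θ f₀ => (D₀ : ℂ) * Λ θ f₀, fun θ f₀ hf₀ hf₀c h0 hpos => ?_, fun f₀ hf₀ hf₀c => ?_⟩
  · -- (i) positivity
    refine mul_ne_zero (Complex.ofReal_ne_zero.2 hD.ne') (hΛpos θ f₀ hf₀ hf₀c h0 ?_)
    obtain ⟨n₀, hn₀, hn₀pos⟩ := hpos
    exact ⟨n₀, hn₀, hn₀pos⟩
  · -- (ii) the reading
    obtain ⟨G, hG, hGev, hG0, hGeq⟩ := hΛ f₀ hf₀ hf₀c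
    refine ⟨fun xθ => (D₀ : ℂ) * G xθ, contDiff_const.mul hG, fun x θ => by dsimp only; rw [hGev], fun θ => by dsimp only; rw [hG0], fun S hw cw hcw => ?_⟩
    -- ★ (T-CONGR): the label enters only through `w ∈ S`; reduce to the reference label `{w}`
    rw [chartOrbHLoc_eq_of_mem_iff L w νw (S := S) (S' := {w}) (by rw [Finset.mem_singleton]; exact ⟨fun _ => rfl, fun _ => hw⟩) _ cw]
    -- ★ (DOCK-w₀): read `chartOrbHLoc L {w} w` through `torusU`, the chart point being `hypBlockGL (cw 0) (cw 2)`
    rw [chartOrbHLoc_eq_of_chartTorusHLoc_eq L {w} w νw (T := TAL) (chartTorusHLoc_eq_torusU L {w} hw1) hTc (iT := iQ') tAL _ cw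
      (LineRing.forall_mem_torusU_comm (starRingEnd ℂ) _ ((chartTorusHLoc_eq_torusU L {w} hw1) ▸ endoBlockAt_mem_chartTorusHLoc L {w} w cw))]
    have hfun : descConj (endoBlockAt L {w} w cw) TAL
          (LineRing.forall_mem_torusU_comm (starRingEnd ℂ) _ ((chartTorusHLoc_eq_torusU L {w} hw1) ▸ endoBlockAt_mem_chartTorusHLoc L {w} w cw))
          (fun g => f₀ ((g : GL (Fin 2) ℂ) : Matrix (Fin 2) (Fin 2) ℂ)) =
        descConj (⟨hypBlockGL (cw 0) (cw 2), hypBlockGL_mem_archLocal L w (cw 0) (cw 2)⟩ : ↥(archLocal L 2 (Matrix.of fun i j : Fin 2 => if i.val + j.val + 1 = 2 then (1 : L) else 0) w)) TAL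
          (fun m hm => LineRing.forall_mem_torusU_comm (starRingEnd ℂ) _ (hypBlockGL_mem_torusU hJ (cw 0) (cw 2)) m hm) (fun g => f₀ ((g : GL (Fin 2) ℂ) : Matrix (Fin 2) (Fin 2) ℂ)) := by
      funext y
      induction y using QuotientGroup.induction_on with
      | H g => rw [descConj_mk, descConj_mk, endoBlockAt_eq_mk_hypBlockGL L {w} hw1 cw]
    rw [hfun]
    have key := hGeq (cw 0) (cw 2) hcw
    rw [Complex.real_smul] at key
    change (((|Real.exp (cw 0) - Real.exp (-(cw 0))| : ℝ) : ℂ) * ((D₀ : ℂ) * ∫ y, descConj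
        (⟨hypBlockGL (cw 0) (cw 2), hypBlockGL_mem_of_eq_over hJ (cw 0) (cw 2)⟩ : ↥(unitaryGroupOfForm (starRingEnd ℂ) ((Matrix.of fun i j : Fin 2 => if i.val + j.val + 1 = 2 then (1 : L) else 0).map w.1.embedding)))
        (torusU (starRingEnd ℂ) ((Matrix.of fun i j : Fin 2 => if i.val + j.val + 1 = 2 then (1 : L) else 0).map w.1.embedding))
        (LineRing.forall_mem_torusU_comm (starRingEnd ℂ) _ (hypBlockGL_mem_torusU hJ (cw 0) (cw 2))) (fun g => f₀ ((g : GL (Fin 2) ℂ) : Matrix (Fin 2) (Fin 2) ℂ)) y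
          ∂(quotientMeasure (torusU (starRingEnd ℂ) ((Matrix.of fun i j : Fin 2 => if i.val + j.val + 1 = 2 then (1 : L) else 0).map w.1.embedding)) t hTc νw'))) = (D₀ : ℂ) * G (cw 0, cw 2)
    rw [← key]
    ring

end Docked

end Literature.NumberTheory.Rogawski1990

end
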